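import Literature.NumberTheory.Automorphic.UnitaryLevelOneVDeepClassGuardsRamified   -- (this seat, A-file): §1 polarisation ∕ no transvections at a residual frame; §2 `guards_of_conj_mem_of_vDeep_ramified`; brings ★ p846992, ★ O8b FILE 3, `classOrbitalIntegral_eq_smul_sum_ncard_strata`
import HarnessLib

/-!
# «(O8b)-ram»: THE SIX-STRATA ORBITAL INTEGRAL of a `v`-LEVEL-1 `K`-class piece at a `v`-DEEP regular class (tame-ramified non-split place) — the consumer form of the
# two-layer (U)-ram head (F0P2-p01 (g15) (R1) ★ p846963 + this seat's (R2)–(R5) ★ p846992) and the producer of STUB A′ (ii) ∕ A₂′ (d) (the `n_{b,j}` of SPEC P1ram-T0)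

Topic `NumberTheory/Automorphic`; namespace `Literature.NumberTheory.Automorphic.UnitaryGroup`.  THEOREMS ONLY (no definition, no instance, no notation, no named fact, no `sorry`).
Hand F0P3a-p05 (g16), 2026-09-01.  Cell `pub/hodgecm-mathlib`, crux H413 = `stmt-HodgeConjecture-24833`; road «S3-ram» seeding wave (LEAD F0P3a-plan (g12) T11-41∕T11-72; owner∕table
F0P3a-p06 (g15) v1.6); the tame-ramified, TWO-LAYER twin of the inert ★ O8b FILE 3 `classOrbitalIntegral_eq_mul_strata_three_of_deep` (`UnitaryDepthZeroPieceOrbitalIntegral`),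
over the place-generic ★ `classOrbitalIntegral_eq_smul_sum_ncard_strata` (`OrbitalIntegralFixedPointStrata`); guards from the A-file `UnitaryLevelOneVDeepClassGuardsRamified`.

THE MATHEMATICS ([Rogawski1990] §4.9 pp. 54–55; [Kottwitz1986] §3; [Laumon1995] (5.3.2)).  `L` CM, `v` finite non-split TAME-RAMIFIED in `L` (`w ∣ v`, `2 ∈ 𝒪_w^×`), `G′_v = U(H′)(L⁺_v)`
with hyperspecial `K′ = U(H′)(𝒪_v)`, residual form `J̄ = red H′_w`.  A `v`-LEVEL-1 piece `g ∈ C_c^∞(G′_v)` (supported in `K′`, `Ad K′`-invariant, left-invariant under `K(ϖ_v) = K_w(2)`)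
takes SIX values on the part of `K′` that meets `v`-deep classes (the two-layer (U)-ram head, rows (R1)–(R5) taken as HYPOTHESES in F0P2-p01 (g15)'s sf v2 42aa586084cc7c78 texts
VERBATIM): `c 2` on the boundary stratum (`rank(red x_w − 1) = 2`; RIGID-2-ram ★ p846963), and on the interior `x_w ≡ 1 (ϖ)` the values `c′ 0 ∣ c′ 2 ∣ c₁ 1, c₁ ε` by the `O(J̄)`-orbit of the
depth-1 residue `N(x) = red(ϖ⁻¹(x_w − 1)) ∈ 𝔭(J̄)` (rank `0 ∣ 2 ∣ 1`, the rank-1 orbits split by the square class of the values of `z ↦ zᵀ(J̄N(x))z`; ★ p846992).  For `t ∈ G′_v` REGULAR with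
compact centraliser and `v`-DEEP (`t_w ≡ 1 (ϖ_v)` — A-p16 (g31) 22:24:50Z: «the clause's `V` must be 2-deep») every conjugate `x = q⁻¹tq ∈ K′` satisfies the head's guards automatically
(A-file §2), so ★ `classOrbitalIntegral_eq_smul_sum_ncard_strata` with the six-valued stratum reader gives
  **`Φ(⟦t⟧, g) = ν(K′) · (c 2·n_bd(t) + c′ 0·n_0(t) + c′ 2·n_reg(t) + c₁ 1·n_□(t) + c₁ ε·n_¬□(t))`**,
the counts over `q ∈ Fix_t(G′_v ⧸ K′)` with `x := q.out⁻¹ t q.out`.  On `n_¬□` every non-zero value of the residual form is `a²ε` (★ `exists_eq_sq_or_eq_sq_mul_of_not_isSquare`, F0P3-p03 (g14));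
a non-zero value exists by polarisation (A-file §1).  This is the `G`-side of the `_le_one`-ram clauses per piece: the clause hands (e1)(e2) now only need CLOSED FORMS for the six counts
at the literals (CERT P1ram-T0, B-p14 (g38) ∕ A-p16 (g31): strata `bd, 0, reg, 1±`), and for a one-stratum indicator piece it is A-p12 (g23)'s «five-strata linearity».
HONEST LABEL: HC_CM is proved only modulo the 2 remaining named inputs (hLiu418 24832, h413 24833) until rung 0 closes; unconditional local algebra ∕ measure bookkeeping, no books consequence.

## References
* [Rogawski1990] J. D. Rogawski, *Automorphic Representations of Unitary Groups in Three Variables*, Ann. of Math. Stud. 123 (1990): §4.9 pp. 54–55, Prop. 4.9.1; §3.9 p. 32.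
* [Kottwitz1986] R. E. Kottwitz, *Base change for unit elements of Hecke algebras*, Compositio Math. 60 (1986): §3 (congruence filtration; fixed points on the building).
* [Laumon1995] G. Laumon, *Cohomology of Drinfeld Modular Varieties* I (1996): Lemma (5.3.2) p. 136 (orbital integrals as weighted fixed-point counts).
-/

set_option autoImplicit false

noncomputable section

open MeasureTheory Measure Set Filter Topology NumberField IsDedekindDomain Matrix ValuativeRel
open Literature.NumberTheory.Rogawski1990 Literature.NumberTheory.GaloisRepresentations Literature.NumberTheory.Automorphic.UnitaryGroup
open Literature.NumberTheory.Automorphic.IntegralReduction Literature.GroupTheory.SpecificGroups Literature.NumberTheory.Automorphic.UnitaryLatticeTree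
open scoped Matrix MatrixGroups ValuativeRel

namespace Literature.NumberTheory.Automorphic.UnitaryGroup

/-! ## §3 THE SIX-STRATA ORBITAL INTEGRAL -/

section Head

/-- `a • Σ_{r<5} m r • c r` unfolded. [folklore] -/
private theorem real_smul_sum_range_five_nsmul (a : ℝ) (m : ℕ → ℕ) (c : ℕ → ℂ) :
    a • ∑ r ∈ Finset.range 5, m r • c r = (a : ℂ) * (c 0 * (m 0 : ℂ) + c 1 * (m 1 : ℂ) + c 2 * (m 2 : ℂ) + c 3 * (m 3 : ℂ) + c 4 * (m 4 : ℂ)) := by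
  rw [Finset.sum_range_succ, Finset.sum_range_succ, Finset.sum_range_succ, Finset.sum_range_succ, Finset.sum_range_succ, Finset.sum_range_zero, zero_add,
    nsmul_eq_mul, nsmul_eq_mul, nsmul_eq_mul, nsmul_eq_mul, nsmul_eq_mul, Complex.real_smul]
  ring

variable (L : Type) [Field L] [NumberField L] [IsCMField L] (H' : Matrix (Fin 3) (Fin 3) L) {v : HeightOneSpectrum (𝓞 ↥(maximalRealSubfield L))}
  [MeasurableSpace ((cmDatum L 3 H').Local v)] [BorelSpace ((cmDatum L 3 H').Local v)]
  [∀ γ : ((cmDatum L 3 H').Local v), MeasurableSpace (((cmDatum L 3 H').Local v) ⧸ Subgroup.centralizer ({γ} : Set ((cmDatum L 3 H').Local v)))]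
  [∀ γ : ((cmDatum L 3 H').Local v), BorelSpace (((cmDatum L 3 H').Local v) ⧸ Subgroup.centralizer ({γ} : Set ((cmDatum L 3 H').Local v)))]
  (νG : Measure ((cmDatum L 3 H').Local v)) [νG.IsHaarMeasure] [νG.IsMulRightInvariant]

set_option maxHeartbeats 1600000 in
-- budget only: statement-heavy declaration (six count sets in the CM-place tokens, five row hypotheses); no search tactic runs long here.
/-- **«(O8b)-ram»: THE SIX-STRATA ORBITAL INTEGRAL OF A `v`-LEVEL-1 `K`-CLASS PIECE AT A `v`-DEEP REGULAR CLASS (tame-ramified non-split place).**  `m_G` canonical for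
(`IsRegularElt`, `ν_G`); `t ∈ G′_v` regular with compact centraliser and `v`-DEEP (`t_w ≡ 1 (ϖ_v)`); `g` locally constant, supported in `K′`, `Ad K′`-invariant; values
`(c, c′, c₁)` satisfying the rows (R1)–(R5) of the two-layer (U)-ram head (F0P2-p01 (g15) sf v2 42aa586084cc7c78 VERBATIM; supplied by ★ `exists_boundaryValue_of_levelOne_ramified` +
★ `exists_depthOneStrataValues_of_levelOne_ramified`); `ε` a residue non-square.  Then
`Φ(⟦t⟧, g) = ν_G(K′) · (c 2 · n_bd(t) + c′ 0 · n_0(t) + c′ 2 · n_reg(t) + c₁ 1 · n_□(t) + c₁ ε · n_¬□(t))`, the counts over `q ∈ Fix_t(G′_v ⧸ K′)` with `x := q.out⁻¹ t q.out`: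
`n_bd` «`rank(red x_w − 1) = 2`», `n_0`∕`n_reg` «`rank(red x_w − 1) = 0 ∧ rank N(x) = 0 ∕ 2`», `n_□` «`rank(red x_w − 1) = 0 ∧ rank N(x) = 1 ∧ ∃ z a, a ≠ 0 ∧ zᵀ(J̄N(x))z = a²·1`»,
`n_¬□` «`rank(red x_w − 1) = 0 ∧ rank N(x) = 1 ∧ ¬∃ z a, a ≠ 0 ∧ zᵀ(J̄N(x))z = a²·1`» (there every non-zero value is `a²ε`, ★ `exists_eq_sq_or_eq_sq_mul_of_not_isSquare`; a non-zero value
exists by §1 polarisation).  ★ `classOrbitalIntegral_eq_smul_sum_ncard_strata` with the six-valued reader; guards by §2.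
[cite: Rogawski1990, §4.9 pp. 54–55, Prop. 4.9.1] [cite: Laumon1995, Lemma (5.3.2) p. 136] [cite: Kottwitz1986, §3] -/
theorem classOrbitalIntegral_eq_mul_sixStrata_of_vDeep_ramified
    (hH' : (H'.map (cmConjRingHom L)).transpose = H') (w : PlacesOver L v)
    (hw : IsCMField.complexConj L • w.1 = w.1) (he : v.asIdeal.ramificationIdx' w.1.asIdeal ≠ 1)
    (hH'w : IsUnit (placeForm H' w.1)) (hH'i : hH'w.unit ∈ glInt 3 (w.1.adicCompletion L))
    (h2 : IsUnit (2 : 𝒪[(w.1.adicCompletion L)]))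
    (ϖ : (w.1.adicCompletion L)) (hϖ : Valued.v ϖ = WithZero.exp (-1 : ℤ)) (hσϖ : (galAdicCompletionMap (L := L) (IsCMField.complexConj L) hw) ϖ = -ϖ)
    (A : GL (Fin 3) (w.1.adicCompletion L)) (hA : A ∈ glInt 3 (w.1.adicCompletion L))
    (hframe : (placeForm H' w.1) = (-(placeForm H' w.1).det) • formCongr (galAdicCompletionMap (L := L) (IsCMField.complexConj L) hw) A ((StdForm.antidiagonal 3).over (w.1.adicCompletion L)))
    {mG : OrbitalMeasureFamily ((cmDatum L 3 H').Local v)} (hmG : mG.IsCanonical (fun γ => IsRegularElt (γ.val : GL (Fin 3) (UnitaryGroup.LocalRing L v))) νG)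
    (t : ((cmDatum L 3 H').Local v)) (hreg : IsRegularElt (t.val : GL (Fin 3) (UnitaryGroup.LocalRing L v)))
    [CompactSpace (Subgroup.centralizer ({t} : Set ((cmDatum L 3 H').Local v)))]
    (htdeep : (∀ a b, Valued.v (((toPlace v w (HeckeCharacter.uniformizer ↥(maximalRealSubfield L) v : v.adicCompletion ↥(maximalRealSubfield L))) ^ 1)⁻¹ * ((((t).val : GL (Fin 3) (UnitaryGroup.LocalRing L v)).val.map (Pi.evalRingHom (fun w' : PlacesOver L v => w'.1.adicCompletion L) w)) a b - (1 : Matrix (Fin 3) (Fin 3) (w.1.adicCompletion L)) a b)) ≤ 1))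
    (g : ((cmDatum L 3 H').Local v) → ℂ) (hg : Literature.NumberTheory.Rogawski1990.IsLocSmooth g) (hgK : tsupport g ⊆ ((cmLocalIntegralLevel L 3 H' v) : Set ((cmDatum L 3 H').Local v)))
    (hginv : ∀ u ∈ (cmLocalIntegralLevel L 3 H' v), ∀ x, g (u * x * u⁻¹) = g x)
    (c c' : ℕ → ℂ) (c₁ : 𝓀[(w.1.adicCompletion L)] → ℂ) (ε : 𝓀[(w.1.adicCompletion L)]) (hε : ¬ IsSquare ε)
    (hR1 : (∀ x : ((cmDatum L 3 H').Local v), (x ∈ cmLocalIntegralLevel L 3 H' v ∧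
        (redMat (((x).val : GL (Fin 3) (UnitaryGroup.LocalRing L v)).val.map (Pi.evalRingHom (fun w' : PlacesOver L v => w'.1.adicCompletion L) w)) - 1) ^ 3 = 0 ∧
        (redMat (((x).val : GL (Fin 3) (UnitaryGroup.LocalRing L v)).val.map (Pi.evalRingHom (fun w' : PlacesOver L v => w'.1.adicCompletion L) w)) - 1).rank = 2 ∧
        ∃ y : ((cmDatum L 3 H').Local v), (∀ a b, Valued.v (((toPlace v w (HeckeCharacter.uniformizer ↥(maximalRealSubfield L) v : v.adicCompletion ↥(maximalRealSubfield L))) ^ 1)⁻¹ *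
          ((((localNonsplitEquiv (IsCMField.complexConj L) H' (IsCMField.complexConj_ne_one L) w hw (y * x * y⁻¹) :
            ↥(unitaryGroupOfForm (galAdicCompletionMap (L := L) (IsCMField.complexConj L) hw) (placeForm H' w.1))) : GL (Fin 3) (w.1.adicCompletion L)) :
              Matrix (Fin 3) (Fin 3) (w.1.adicCompletion L)) a b - (1 : Matrix (Fin 3) (Fin 3) (w.1.adicCompletion L)) a b)) ≤ 1)) →
        g x = c 2))
    (hR2 : (∀ x : ((cmDatum L 3 H').Local v), (x ∈ cmLocalIntegralLevel L 3 H' v ∧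
        (∀ a b, Valued.v (ϖ⁻¹ * ((((x).val : GL (Fin 3) (UnitaryGroup.LocalRing L v)).val.map (Pi.evalRingHom (fun w' : PlacesOver L v => w'.1.adicCompletion L) w)) a b - (1 : Matrix (Fin 3) (Fin 3) (w.1.adicCompletion L)) a b)) ≤ 1) ∧
        (redMat (ϖ⁻¹ • ((((x).val : GL (Fin 3) (UnitaryGroup.LocalRing L v)).val.map (Pi.evalRingHom (fun w' : PlacesOver L v => w'.1.adicCompletion L) w)) - 1))) ^ 3 = 0 ∧ (redMat (ϖ⁻¹ • ((((x).val : GL (Fin 3) (UnitaryGroup.LocalRing L v)).val.map (Pi.evalRingHom (fun w' : PlacesOver L v => w'.1.adicCompletion L) w)) - 1))).rank = 0) →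
        g x = c' 0))
    (hR3 : (∀ x : ((cmDatum L 3 H').Local v), (x ∈ cmLocalIntegralLevel L 3 H' v ∧
        (∀ a b, Valued.v (ϖ⁻¹ * ((((x).val : GL (Fin 3) (UnitaryGroup.LocalRing L v)).val.map (Pi.evalRingHom (fun w' : PlacesOver L v => w'.1.adicCompletion L) w)) a b - (1 : Matrix (Fin 3) (Fin 3) (w.1.adicCompletion L)) a b)) ≤ 1) ∧
        (redMat (ϖ⁻¹ • ((((x).val : GL (Fin 3) (UnitaryGroup.LocalRing L v)).val.map (Pi.evalRingHom (fun w' : PlacesOver L v => w'.1.adicCompletion L) w)) - 1))) ^ 3 = 0 ∧ (redMat (ϖ⁻¹ • ((((x).val : GL (Fin 3) (UnitaryGroup.LocalRing L v)).val.map (Pi.evalRingHom (fun w' : PlacesOver L v => w'.1.adicCompletion L) w)) - 1))).rank = 2) →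
        g x = c' 2))
    (hR4 : (∀ (x : ((cmDatum L 3 H').Local v)) (z : Fin 3 → 𝓀[(w.1.adicCompletion L)]), (x ∈ cmLocalIntegralLevel L 3 H' v ∧
        (∀ a b, Valued.v (ϖ⁻¹ * ((((x).val : GL (Fin 3) (UnitaryGroup.LocalRing L v)).val.map (Pi.evalRingHom (fun w' : PlacesOver L v => w'.1.adicCompletion L) w)) a b - (1 : Matrix (Fin 3) (Fin 3) (w.1.adicCompletion L)) a b)) ≤ 1) ∧
        (redMat (ϖ⁻¹ • ((((x).val : GL (Fin 3) (UnitaryGroup.LocalRing L v)).val.map (Pi.evalRingHom (fun w' : PlacesOver L v => w'.1.adicCompletion L) w)) - 1))) ^ 3 = 0 ∧ (redMat (ϖ⁻¹ • ((((x).val : GL (Fin 3) (UnitaryGroup.LocalRing L v)).val.map (Pi.evalRingHom (fun w' : PlacesOver L v => w'.1.adicCompletion L) w)) - 1))).rank = 1 ∧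
        z ⬝ᵥ ((redMat (placeForm H' w.1) * redMat (ϖ⁻¹ • ((((x).val : GL (Fin 3) (UnitaryGroup.LocalRing L v)).val.map (Pi.evalRingHom (fun w' : PlacesOver L v => w'.1.adicCompletion L) w)) - 1))) *ᵥ z) ≠ 0) →
        g x = c₁ (z ⬝ᵥ ((redMat (placeForm H' w.1) * redMat (ϖ⁻¹ • ((((x).val : GL (Fin 3) (UnitaryGroup.LocalRing L v)).val.map (Pi.evalRingHom (fun w' : PlacesOver L v => w'.1.adicCompletion L) w)) - 1))) *ᵥ z))))
    (hR5 : (∀ t a : 𝓀[(w.1.adicCompletion L)], a ≠ 0 → c₁ (a ^ 2 * t) = c₁ t)) :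
    classOrbitalIntegral mG g (ConjClasses.mk t) =
      (νG.real ((cmLocalIntegralLevel L 3 H' v) : Set ((cmDatum L 3 H').Local v)) : ℂ) *
        (c 2 * ({q : (((cmDatum L 3 H').Local v) ⧸ cmLocalIntegralLevel L 3 H' v) | q ∈ MulAction.fixedBy (((cmDatum L 3 H').Local v) ⧸ cmLocalIntegralLevel L 3 H' v) t ∧ (redMat (((((q.out⁻¹ * t * q.out)).val : GL (Fin 3) (UnitaryGroup.LocalRing L v)).val.map (Pi.evalRingHom (fun w' : PlacesOver L v => w'.1.adicCompletion L) w))) - 1).rank = 2}.ncard : ℂ) +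
          c' 0 * ({q : (((cmDatum L 3 H').Local v) ⧸ cmLocalIntegralLevel L 3 H' v) | q ∈ MulAction.fixedBy (((cmDatum L 3 H').Local v) ⧸ cmLocalIntegralLevel L 3 H' v) t ∧ (redMat (((((q.out⁻¹ * t * q.out)).val : GL (Fin 3) (UnitaryGroup.LocalRing L v)).val.map (Pi.evalRingHom (fun w' : PlacesOver L v => w'.1.adicCompletion L) w))) - 1).rank = 0 ∧ (redMat (ϖ⁻¹ • (((((q.out⁻¹ * t * q.out)).val : GL (Fin 3) (UnitaryGroup.LocalRing L v)).val.map (Pi.evalRingHom (fun w' : PlacesOver L v => w'.1.adicCompletion L) w)) - 1))).rank = 0}.ncard : ℂ) +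
          c' 2 * ({q : (((cmDatum L 3 H').Local v) ⧸ cmLocalIntegralLevel L 3 H' v) | q ∈ MulAction.fixedBy (((cmDatum L 3 H').Local v) ⧸ cmLocalIntegralLevel L 3 H' v) t ∧ (redMat (((((q.out⁻¹ * t * q.out)).val : GL (Fin 3) (UnitaryGroup.LocalRing L v)).val.map (Pi.evalRingHom (fun w' : PlacesOver L v => w'.1.adicCompletion L) w))) - 1).rank = 0 ∧ (redMat (ϖ⁻¹ • (((((q.out⁻¹ * t * q.out)).val : GL (Fin 3) (UnitaryGroup.LocalRing L v)).val.map (Pi.evalRingHom (fun w' : PlacesOver L v => w'.1.adicCompletion L) w)) - 1))).rank = 2}.ncard : ℂ) +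
          c₁ 1 * ({q : (((cmDatum L 3 H').Local v) ⧸ cmLocalIntegralLevel L 3 H' v) | q ∈ MulAction.fixedBy (((cmDatum L 3 H').Local v) ⧸ cmLocalIntegralLevel L 3 H' v) t ∧ (redMat (((((q.out⁻¹ * t * q.out)).val : GL (Fin 3) (UnitaryGroup.LocalRing L v)).val.map (Pi.evalRingHom (fun w' : PlacesOver L v => w'.1.adicCompletion L) w))) - 1).rank = 0 ∧ (redMat (ϖ⁻¹ • (((((q.out⁻¹ * t * q.out)).val : GL (Fin 3) (UnitaryGroup.LocalRing L v)).val.map (Pi.evalRingHom (fun w' : PlacesOver L v => w'.1.adicCompletion L) w)) - 1))).rank = 1 ∧ ∃ (z : Fin 3 → 𝓀[(w.1.adicCompletion L)]) (a : 𝓀[(w.1.adicCompletion L)]), a ≠ 0 ∧ z ⬝ᵥ ((redMat (placeForm H' w.1) * redMat (ϖ⁻¹ • (((((q.out⁻¹ * t * q.out)).val : GL (Fin 3) (UnitaryGroup.LocalRing L v)).val.map (Pi.evalRingHom (fun w' : PlacesOver L v => w'.1.adicCompletion L) w)) - 1))) *ᵥ z) = a ^ 2}.ncard : ℂ) +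
          c₁ ε * ({q : (((cmDatum L 3 H').Local v) ⧸ cmLocalIntegralLevel L 3 H' v) | q ∈ MulAction.fixedBy (((cmDatum L 3 H').Local v) ⧸ cmLocalIntegralLevel L 3 H' v) t ∧ (redMat (((((q.out⁻¹ * t * q.out)).val : GL (Fin 3) (UnitaryGroup.LocalRing L v)).val.map (Pi.evalRingHom (fun w' : PlacesOver L v => w'.1.adicCompletion L) w))) - 1).rank = 0 ∧ (redMat (ϖ⁻¹ • (((((q.out⁻¹ * t * q.out)).val : GL (Fin 3) (UnitaryGroup.LocalRing L v)).val.map (Pi.evalRingHom (fun w' : PlacesOver L v => w'.1.adicCompletion L) w)) - 1))).rank = 1 ∧ ¬ ∃ (z : Fin 3 → 𝓀[(w.1.adicCompletion L)]) (a : 𝓀[(w.1.adicCompletion L)]), a ≠ 0 ∧ z ⬝ᵥ ((redMat (placeForm H' w.1) * redMat (ϖ⁻¹ • (((((q.out⁻¹ * t * q.out)).val : GL (Fin 3) (UnitaryGroup.LocalRing L v)).val.map (Pi.evalRingHom (fun w' : PlacesOver L v => w'.1.adicCompletion L) w)) - 1))) *ᵥ z) = a ^ 2}.ncard : ℂ))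 := by
  classical
  have hc1 : IsCMField.complexConj L ≠ 1 := IsCMField.complexConj_ne_one L
  letI : Fintype 𝓀[(w.1.adicCompletion L)] := Fintype.ofFinite _
  have h2k : (2 : 𝓀[(w.1.adicCompletion L)]) ≠ 0 := by
    have h := h2.map (IsLocalRing.residue 𝒪[(w.1.adicCompletion L)])
    rw [map_ofNat] at h
    exact h.ne_zero
  -- `det H′ ≠ 0` from the unimodularity of `H′_w`
  have hdet : H'.det ≠ 0 := by
    intro h0
    have hu := (Matrix.isUnit_iff_isUnit_det _).1 hH'w
    have hd : ((placeForm H' w.1)).det = 0 := by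
      rw [placeForm, ← RingHom.mapMatrix_apply, ← RingHom.map_det, h0, map_zero]
    exact hu.ne_zero hd
  -- `J̄` is symmetric and invertible
  have hJint : ∀ i j, (placeForm H' w.1) i j ∈ 𝒪[(w.1.adicCompletion L)] := fun i j => ((mem_glInt_iff _).1 hH'i).1 i j
  have hJinv : ∀ i j, (((hH'w.unit⁻¹ : (Matrix (Fin 3) (Fin 3) (w.1.adicCompletion L))ˣ) : Matrix (Fin 3) (Fin 3) (w.1.adicCompletion L))) i j ∈ 𝒪[(w.1.adicCompletion L)] :=
    fun i j => ((mem_glInt_iff _).1 hH'i).2 i j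
  have hJbardet : IsUnit (redMat (placeForm H' w.1)).det := by
    let JO : Matrix (Fin 3) (Fin 3) 𝒪[(w.1.adicCompletion L)] := Matrix.of fun i j => ⟨(placeForm H' w.1) i j, hJint i j⟩
    have hJ : (placeForm H' w.1) = JO.map ((↑) : 𝒪[(w.1.adicCompletion L)] → (w.1.adicCompletion L)) := by ext i j; rfl
    have hinjO : Function.Injective (fun M : Matrix (Fin 3) (Fin 3) 𝒪[(w.1.adicCompletion L)] => M.map ((↑) : 𝒪[(w.1.adicCompletion L)] → (w.1.adicCompletion L))) :=
      Matrix.map_injective Subtype.val_injective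
    have hJOdet : IsUnit JO.det := by
      let JI : Matrix (Fin 3) (Fin 3) 𝒪[(w.1.adicCompletion L)] :=
        Matrix.of fun i j => ⟨(((hH'w.unit⁻¹ : (Matrix (Fin 3) (Fin 3) (w.1.adicCompletion L))ˣ) : Matrix (Fin 3) (Fin 3) (w.1.adicCompletion L))) i j, hJinv i j⟩
      have hJI : (((hH'w.unit⁻¹ : (Matrix (Fin 3) (Fin 3) (w.1.adicCompletion L))ˣ) : Matrix (Fin 3) (Fin 3) (w.1.adicCompletion L))) = JI.map ((↑) : 𝒪[(w.1.adicCompletion L)] → (w.1.adicCompletion L)) := by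
        ext i j; rfl
      have hmul : JO * JI = 1 := by
        apply hinjO
        change (JO * JI).map ⇑(𝒪[(w.1.adicCompletion L)]).subtype = (1 : Matrix (Fin 3) (Fin 3) 𝒪[(w.1.adicCompletion L)]).map ⇑(𝒪[(w.1.adicCompletion L)]).subtype
        rw [Matrix.map_mul, Matrix.map_one (𝒪[(w.1.adicCompletion L)]).subtype (map_zero _) (map_one _)]
        change JO.map ((↑) : 𝒪[(w.1.adicCompletion L)] → (w.1.adicCompletion L)) * JI.map ((↑) : 𝒪[(w.1.adicCompletion L)] → (w.1.adicCompletion L)) = 1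
        rw [← hJ, ← hJI]
        have hmi := hH'w.unit.mul_inv
        rw [hH'w.unit_spec] at hmi
        exact hmi
      exact Matrix.isUnit_det_of_right_inverse hmul
    have hJred : redMat (placeForm H' w.1) = JO.map (IsLocalRing.residue 𝒪[(w.1.adicCompletion L)]) := by rw [hJ]; exact redMat_mapMatrix JO
    rw [hJred, ← RingHom.mapMatrix_apply, ← RingHom.map_det]
    exact hJOdet.map _
  have hJbT : (redMat (placeForm H' w.1))ᵀ = redMat (placeForm H' w.1) := by
    have hJσ : (((placeForm H' w.1)).map (galAdicCompletionMap (L := L) (IsCMField.complexConj L) hw))ᵀ = (placeForm H' w.1) := placeForm_hermitian_of_smul_eq (c := IsCMField.complexConj L) w H' hH' hw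
    have hT : ((placeForm H' w.1))ᵀ = ((placeForm H' w.1)).map (galAdicCompletionMap (L := L) (IsCMField.complexConj L) hw) := by
      conv_lhs => rw [← hJσ]
      rw [Matrix.transpose_transpose]
    rw [← redMat_transpose, hT]
    exact redMat_map_galAdicCompletionMap_eq_of_ramified L v w hw he hJint
  -- the non-zero value of a rank-1 symmetric residue (polarisation)
  have hval_exists : ∀ k : ((cmDatum L 3 H').Local v), k ∈ (cmLocalIntegralLevel L 3 H' v) → (∀ a b, Valued.v (ϖ⁻¹ * ((((k).val : GL (Fin 3) (UnitaryGroup.LocalRing L v)).val.map (Pi.evalRingHom (fun w' : PlacesOver L v => w'.1.adicCompletion L) w)) a b - (1 : Matrix (Fin 3) (Fin 3) (w.1.adicCompletion L)) a b)) ≤ 1) → (redMat (ϖ⁻¹ • ((((k).val : GL (Fin 3) (UnitaryGroup.LocalRing L v)).val.map (Pi.evalRingHom (fun w' : PlacesOver L v => w'.1.adicCompletion L) w)) - 1))).rank = 1 → ∃ z : Fin 3 → 𝓀[(w.1.adicCompletion L)], z ⬝ᵥ ((redMat (placeForm H' w.1) * redMat (ϖ⁻¹ • ((((k).val : GL (Fin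 3) (UnitaryGroup.LocalRing L v)).val.map (Pi.evalRingHom (fun w' : PlacesOver L v => w'.1.adicCompletion L) w)) - 1))) *ᵥ z) ≠ 0 := by
    intro k hk hk1 hr1
    have hsym := redMat_placeForm_mul_depthOne_eq_transpose_mul_of_ramified L H' w hw he hH'w hH'i ϖ hϖ hσϖ hk hk1
    refine exists_dotProduct_mulVec_ne_zero_of_transpose_eq h2k ?_ ?_
    · rw [Matrix.transpose_mul, hJbT, ← hsym]
    · intro h0
      have hN0 : redMat (ϖ⁻¹ • ((((k).val : GL (Fin 3) (UnitaryGroup.LocalRing L v)).val.map (Pi.evalRingHom (fun w' : PlacesOver L v => w'.1.adicCompletion L) w)) - 1)) = 0 := by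
        have h := congrArg (fun M => (redMat (placeForm H' w.1))⁻¹ * M) h0
        simp only [Matrix.mul_zero] at h
        rwa [← Matrix.mul_assoc, Matrix.nonsing_inv_mul _ hJbardet, Matrix.one_mul] at h
      rw [hN0, Matrix.rank_zero] at hr1
      exact zero_ne_one hr1
  -- §A an OPAQUE six-valued stratum reader `ρ` and value vector `cv` (keeps the kernel terms small)
  obtain ⟨ρ, hρ⟩ : ∃ ρ : ((cmDatum L 3 H').Local v) → ℕ, ∀ k, ρ k = (if (redMat ((((k).val : GL (Fin 3) (UnitaryGroup.LocalRing L v)).val.map (Pi.evalRingHom (fun w' : PlacesOver L v => w'.1.adicCompletion L) w))) - 1).rank = 2 then 0 else if (redMat (ϖ⁻¹ • ((((k).val : GL (Fin 3) (UnitaryGroup.LocalRing L v)).val.map (Pi.evalRingHom (fun w' : PlacesOver L v => w'.1.adicCompletion L) w)) - 1))).rank = 0 then 1 else if (redMat (ϖ⁻¹ • ((((k).val : GL (Fin 3) (UnitaryGroup.LocalRing L v)).val.map (Pi.evalRingHom (fun w' : PlacesOver L v => w'.1.adicCompletion L) w)) - 1))).rank = 2 then 2 else if (∃ (z : Fin 3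 → 𝓀[(w.1.adicCompletion L)]) (a : 𝓀[(w.1.adicCompletion L)]), a ≠ 0 ∧ z ⬝ᵥ ((redMat (placeForm H' w.1) * redMat (ϖ⁻¹ • ((((k).val : GL (Fin 3) (UnitaryGroup.LocalRing L v)).val.map (Pi.evalRingHom (fun w' : PlacesOver L v => w'.1.adicCompletion L) w)) - 1))) *ᵥ z) = a ^ 2) then 3 else 4) := ⟨_, fun _ => rfl⟩
  obtain ⟨cv, hcv0, hcv1, hcv2, hcv3, hcv4⟩ : ∃ cv : ℕ → ℂ, cv 0 = c 2 ∧ cv 1 = c' 0 ∧ cv 2 = c' 2 ∧ cv 3 = c₁ 1 ∧ cv 4 = c₁ ε :=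
    ⟨fun r => if r = 0 then c 2 else if r = 1 then c' 0 else if r = 2 then c' 2 else if r = 3 then c₁ 1 else c₁ ε,
      by simp, by simp, by simp, by simp, by simp⟩
  -- the place-generic strata lemma ★ `classOrbitalIntegral_eq_smul_sum_ncard_strata`; guards by §2
  refine (classOrbitalIntegral_eq_smul_sum_ncard_strata (P := fun γ : ((cmDatum L 3 H').Local v) => IsRegularElt (γ.val : GL (Fin 3) (UnitaryGroup.LocalRing L v)))
    (fun g' x hg' => isRegularElt_val_conj L 3 H' v g' x hg') hmG hreg (cmLocalIntegralLevel L 3 H' v)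
    (isCompact_isOpen_cmLocalIntegralLevel L 3 H' v).2 (isCompact_isOpen_cmLocalIntegralLevel L 3 H' v).1
    (isClosed_conjClass_local_of_isRegularElt L 3 H' v hH' hdet t hreg) g hg.1.continuous
    ((subset_tsupport g).trans hgK) hginv
    {k : ((cmDatum L 3 H').Local v) | ((redMat ((((k).val : GL (Fin 3) (UnitaryGroup.LocalRing L v)).val.map (Pi.evalRingHom (fun w' : PlacesOver L v => w'.1.adicCompletion L) w))) - 1).rank ≠ 1 ∧ (redMat ((((k).val : GL (Fin 3) (UnitaryGroup.LocalRing L v)).val.map (Pi.evalRingHom (fun w' : PlacesOver L v => w'.1.adicCompletion L) w))) - 1) ^ 3 = 0) ∧ ((redMat ((((k).val : GL (Fin 3) (UnitaryGroup.LocalRing L v)).val.map (Pi.evalRingHom (fun w' : PlacesOver L v => w'.1.adicCompletion L) w))) - 1).rank = 0 → (∀ a b, Valued.v (ϖ⁻¹ * ((((k).val : GL (Fin 3) (UnitaryGroup.LocalRing L v)).val.map (Pi.evalRingHom (fun w' : PlacesOver L v => w'.1.adicCompletion L) w)) a b - (1 : Matrix (Fin 3) (Fin 3) (w.1.adicCompletion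 L)) a b)) ≤ 1) ∧ (redMat (ϖ⁻¹ • ((((k).val : GL (Fin 3) (UnitaryGroup.LocalRing L v)).val.map (Pi.evalRingHom (fun w' : PlacesOver L v => w'.1.adicCompletion L) w)) - 1))) ^ 3 = 0) ∧
      (∃ y : ((cmDatum L 3 H').Local v), (∀ a b, Valued.v (((toPlace v w (HeckeCharacter.uniformizer ↥(maximalRealSubfield L) v : v.adicCompletion ↥(maximalRealSubfield L))) ^ 1)⁻¹ * (((((localNonsplitEquiv (IsCMField.complexConj L) H' (IsCMField.complexConj_ne_one L) w hw (y * k * y⁻¹)) : ↥(unitaryGroupOfForm (galAdicCompletionMap (L := L) (IsCMField.complexConj L) hw) (placeForm H' w.1))) : GL (Fin 3) (w.1.adicCompletion L)) : Matrix (Fin 3) (Fin 3) (w.1.adicCompletion L)) a b - (1 : Matrix (Fin 3) (Fin 3) (w.1.adicCompletion L)) a b)) ≤ 1))}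
    ρ cv 5 ?_ ?_ (fun x hx => guards_of_conj_mem_of_vDeep_ramified L H' w hw he hH'w hH'i h2 ϖ hϖ A hA hframe t htdeep x hx)).trans ?_
  · -- §B the VALUE LAW on `K′ ∩ U`: the rows (R1)–(R5)
    rintro k hk ⟨⟨hne1, hnil1⟩, hint, ⟨y, hy⟩⟩
    rw [hρ]
    have hlt3 : (redMat ((((k).val : GL (Fin 3) (UnitaryGroup.LocalRing L v)).val.map (Pi.evalRingHom (fun w' : PlacesOver L v => w'.1.adicCompletion L) w))) - 1).rank < 3 := rank_lt_of_isNilpotent ⟨3, hnil1⟩ (by norm_num)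
    by_cases hb : (redMat ((((k).val : GL (Fin 3) (UnitaryGroup.LocalRing L v)).val.map (Pi.evalRingHom (fun w' : PlacesOver L v => w'.1.adicCompletion L) w))) - 1).rank = 2
    · rw [if_pos hb, hcv0]
      exact hR1 k ⟨hk, hnil1, hb, y, hy⟩
    · have hr0 : (redMat ((((k).val : GL (Fin 3) (UnitaryGroup.LocalRing L v)).val.map (Pi.evalRingHom (fun w' : PlacesOver L v => w'.1.adicCompletion L) w))) - 1).rank = 0 := by omega
      obtain ⟨hik, hN3⟩ := hint hr0
      have hNlt : (redMat (ϖ⁻¹ • ((((k).val : GL (Fin 3) (UnitaryGroup.LocalRing L v)).val.map (Pi.evalRingHom (fun w' : PlacesOver L v => w'.1.adicCompletion L) w)) - 1))).rank < 3 := rank_lt_of_isNilpotent ⟨3, hN3⟩ (by norm_num)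
      by_cases h0 : (redMat (ϖ⁻¹ • ((((k).val : GL (Fin 3) (UnitaryGroup.LocalRing L v)).val.map (Pi.evalRingHom (fun w' : PlacesOver L v => w'.1.adicCompletion L) w)) - 1))).rank = 0
      · rw [if_neg hb, if_pos h0, hcv1]
        exact hR2 k ⟨hk, hik, hN3, h0⟩
      · by_cases h2' : (redMat (ϖ⁻¹ • ((((k).val : GL (Fin 3) (UnitaryGroup.LocalRing L v)).val.map (Pi.evalRingHom (fun w' : PlacesOver L v => w'.1.adicCompletion L) w)) - 1))).rank = 2
        · rw [if_neg hb, if_neg h0, if_pos h2', hcv2]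
          exact hR3 k ⟨hk, hik, hN3, h2'⟩
        · have h1 : (redMat (ϖ⁻¹ • ((((k).val : GL (Fin 3) (UnitaryGroup.LocalRing L v)).val.map (Pi.evalRingHom (fun w' : PlacesOver L v => w'.1.adicCompletion L) w)) - 1))).rank = 1 := by omega
          by_cases hsq : ∃ (z : Fin 3 → 𝓀[(w.1.adicCompletion L)]) (a : 𝓀[(w.1.adicCompletion L)]), a ≠ 0 ∧ z ⬝ᵥ ((redMat (placeForm H' w.1) * redMat (ϖ⁻¹ • ((((k).val : GL (Fin 3) (UnitaryGroup.LocalRing L v)).val.map (Pi.evalRingHom (fun w' : PlacesOver L v => w'.1.adicCompletion L) w)) - 1))) *ᵥ z) = a ^ 2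
          · rw [if_neg hb, if_neg h0, if_neg h2', if_pos hsq, hcv3]
            obtain ⟨z, a, ha, hz⟩ := hsq
            have hzne : z ⬝ᵥ ((redMat (placeForm H' w.1) * redMat (ϖ⁻¹ • ((((k).val : GL (Fin 3) (UnitaryGroup.LocalRing L v)).val.map (Pi.evalRingHom (fun w' : PlacesOver L v => w'.1.adicCompletion L) w)) - 1))) *ᵥ z) ≠ 0 := by rw [hz]; exact pow_ne_zero 2 ha
            rw [hR4 k z ⟨hk, hik, hN3, h1, hzne⟩, hz, ← mul_one (a ^ 2), hR5 1 a ha]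
          · rw [if_neg hb, if_neg h0, if_neg h2', if_neg hsq, hcv4]
            obtain ⟨z, hzne⟩ := hval_exists k hk hik h1
            rcases exists_eq_sq_or_eq_sq_mul_of_not_isSquare hε hzne with ⟨a, ha⟩ | ⟨a, ha⟩
            · exact absurd ⟨z, a, fun h0' => hzne (by rw [ha, h0']; ring), by rw [ha, mul_one]⟩ hsq
            · have hane : a ≠ 0 := fun h0' => hzne (by rw [ha, h0']; ring)
              rw [hR4 k z ⟨hk, hik, hN3, h1, hzne⟩, ha, hR5 ε a hane]
  · -- the reader is `< 5`
    intro k _ _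
    rw [hρ]
    split_ifs <;> norm_num
  · -- §C unfold the five counts: on a fixed coset the reader's branches are the clean strata (§2 guards)
    have hfix : ∀ q : (((cmDatum L 3 H').Local v) ⧸ cmLocalIntegralLevel L 3 H' v), q ∈ MulAction.fixedBy (((cmDatum L 3 H').Local v) ⧸ cmLocalIntegralLevel L 3 H' v) t →
        (redMat (((((q.out⁻¹ * t * q.out)).val : GL (Fin 3) (UnitaryGroup.LocalRing L v)).val.map (Pi.evalRingHom (fun w' : PlacesOver L v => w'.1.adicCompletion L) w))) - 1).rank < 3 ∧ (redMat (((((q.out⁻¹ * t * q.out)).val : GL (Fin 3) (UnitaryGroup.LocalRing L v)).val.map (Pi.evalRingHom (fun w' : PlacesOver L v => w'.1.adicCompletion L) w))) - 1).rank ≠ 1 ∧ ((redMat (((((q.out⁻¹ * t * q.out)).val : GL (Fin 3) (UnitaryGroup.LocalRing L v)).val.map (Pi.evalRingHom (fun w' : PlacesOver L v => w'.1.adicCompletion L) w))) - 1).rank = 0 → (redMat (ϖ⁻¹ • (((((q.out⁻¹ * t * q.out)).val : GL (Fin 3) (UnitaryGroup.LocalRing L v)).val.map (Pi.evalRingHom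 (fun w' : PlacesOver L v => w'.1.adicCompletion L) w)) - 1))).rank < 3) := by
      intro q hq
      have hxK := inv_out_mul_mul_out_mem_of_mem_fixedBy (cmLocalIntegralLevel L 3 H' v) t hq
      obtain ⟨⟨hne1, hnil1⟩, hint, -⟩ := guards_of_conj_mem_of_vDeep_ramified L H' w hw he hH'w hH'i h2 ϖ hϖ A hA hframe t htdeep q.out hxK
      exact ⟨rank_lt_of_isNilpotent ⟨3, hnil1⟩ (by norm_num), hne1, fun hr0 => rank_lt_of_isNilpotent ⟨3, (hint hr0).2⟩ (by norm_num)⟩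
    have hn0 : {q : (((cmDatum L 3 H').Local v) ⧸ cmLocalIntegralLevel L 3 H' v) | q ∈ MulAction.fixedBy (((cmDatum L 3 H').Local v) ⧸ cmLocalIntegralLevel L 3 H' v) t ∧ ρ (q.out⁻¹ * t * q.out) = 0}.ncard =
        {q : (((cmDatum L 3 H').Local v) ⧸ cmLocalIntegralLevel L 3 H' v) | q ∈ MulAction.fixedBy (((cmDatum L 3 H').Local v) ⧸ cmLocalIntegralLevel L 3 H' v) t ∧ (redMat (((((q.out⁻¹ * t * q.out)).val : GL (Fin 3) (UnitaryGroup.LocalRing L v)).val.map (Pi.evalRingHom (fun w' : PlacesOver L v => w'.1.adicCompletion L) w))) - 1).rank = 2}.ncard := by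
      congr 1
      refine Set.ext fun q => and_congr_right fun hq => ?_
      obtain ⟨hlt, hne, hN⟩ := hfix q hq
      constructor
      · -- reader = 0 ⇒ stratum
        intro h
        rw [hρ] at h
        by_cases hb : (redMat (((((q.out⁻¹ * t * q.out)).val : GL (Fin 3) (UnitaryGroup.LocalRing L v)).val.map (Pi.evalRingHom (fun w' : PlacesOver L v => w'.1.adicCompletion L) w))) - 1).rank = 2
        · rw [if_pos hb] at h; exact hb
        · have hr0 : (redMat (((((q.out⁻¹ * t * q.out)).val : GL (Fin 3) (UnitaryGroup.LocalRing L v)).val.map (Pi.evalRingHom (fun w' : PlacesOver L v => w'.1.adicCompletion L) w))) - 1).rank = 0 := by omega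
          have hN' := hN hr0
          rw [if_neg hb] at h
          by_cases h0 : (redMat (ϖ⁻¹ • (((((q.out⁻¹ * t * q.out)).val : GL (Fin 3) (UnitaryGroup.LocalRing L v)).val.map (Pi.evalRingHom (fun w' : PlacesOver L v => w'.1.adicCompletion L) w)) - 1))).rank = 0
          · rw [if_pos h0] at h; exact absurd h (by decide)
          · rw [if_neg h0] at h
            by_cases h3 : (redMat (ϖ⁻¹ • (((((q.out⁻¹ * t * q.out)).val : GL (Fin 3) (UnitaryGroup.LocalRing L v)).val.map (Pi.evalRingHom (fun w' : PlacesOver L v => w'.1.adicCompletion L) w)) - 1))).rank = 2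
            · rw [if_pos h3] at h; exact absurd h (by decide)
            · rw [if_neg h3] at h
              by_cases h4 : ∃ (z : Fin 3 → 𝓀[(w.1.adicCompletion L)]) (a : 𝓀[(w.1.adicCompletion L)]), a ≠ 0 ∧ z ⬝ᵥ ((redMat (placeForm H' w.1) * redMat (ϖ⁻¹ • (((((q.out⁻¹ * t * q.out)).val : GL (Fin 3) (UnitaryGroup.LocalRing L v)).val.map (Pi.evalRingHom (fun w' : PlacesOver L v => w'.1.adicCompletion L) w)) - 1))) *ᵥ z) = a ^ 2
              · rw [if_pos h4] at h; exact absurd h (by decide)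
              · rw [if_neg h4] at h; exact absurd h (by decide)
      · -- stratum ⇒ reader = 0
        intro h
        rw [hρ, if_pos h]
    have hn1 : {q : (((cmDatum L 3 H').Local v) ⧸ cmLocalIntegralLevel L 3 H' v) | q ∈ MulAction.fixedBy (((cmDatum L 3 H').Local v) ⧸ cmLocalIntegralLevel L 3 H' v) t ∧ ρ (q.out⁻¹ * t * q.out) = 1}.ncard =
        {q : (((cmDatum L 3 H').Local v) ⧸ cmLocalIntegralLevel L 3 H' v) | q ∈ MulAction.fixedBy (((cmDatum L 3 H').Local v) ⧸ cmLocalIntegralLevel L 3 H' v) t ∧ ((redMat (((((q.out⁻¹ * t * q.out)).val : GL (Fin 3) (UnitaryGroup.LocalRing L v)).val.map (Pi.evalRingHom (fun w' : PlacesOver L v => w'.1.adicCompletion L) w))) - 1).rank = 0 ∧ (redMat (ϖ⁻¹ • (((((q.out⁻¹ * t * q.out)).val : GL (Fin 3) (UnitaryGroup.LocalRing L v)).val.map (Pi.evalRingHom (fun w' : PlacesOver L v => w'.1.adicCompletion L) w)) - 1))).rank = 0)}.ncard := by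
      congr 1
      refine Set.ext fun q => and_congr_right fun hq => ?_
      obtain ⟨hlt, hne, hN⟩ := hfix q hq
      constructor
      · -- reader = 1 ⇒ stratum
        intro h
        rw [hρ] at h
        by_cases hb : (redMat (((((q.out⁻¹ * t * q.out)).val : GL (Fin 3) (UnitaryGroup.LocalRing L v)).val.map (Pi.evalRingHom (fun w' : PlacesOver L v => w'.1.adicCompletion L) w))) - 1).rank = 2
        · rw [if_pos hb] at h; exact absurd h (by decide)
        · have hr0 : (redMat (((((q.out⁻¹ * t * q.out)).val : GL (Fin 3) (UnitaryGroup.LocalRing L v)).val.map (Pi.evalRingHom (fun w' : PlacesOver L v => w'.1.adicCompletion L) w))) - 1).rank = 0 := by omega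
          have hN' := hN hr0
          rw [if_neg hb] at h
          by_cases h0 : (redMat (ϖ⁻¹ • (((((q.out⁻¹ * t * q.out)).val : GL (Fin 3) (UnitaryGroup.LocalRing L v)).val.map (Pi.evalRingHom (fun w' : PlacesOver L v => w'.1.adicCompletion L) w)) - 1))).rank = 0
          · rw [if_pos h0] at h; exact ⟨hr0, h0⟩
          · rw [if_neg h0] at h
            by_cases h3 : (redMat (ϖ⁻¹ • (((((q.out⁻¹ * t * q.out)).val : GL (Fin 3) (UnitaryGroup.LocalRing L v)).val.map (Pi.evalRingHom (fun w' : PlacesOver L v => w'.1.adicCompletion L) w)) - 1))).rank = 2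
            · rw [if_pos h3] at h; exact absurd h (by decide)
            · rw [if_neg h3] at h
              by_cases h4 : ∃ (z : Fin 3 → 𝓀[(w.1.adicCompletion L)]) (a : 𝓀[(w.1.adicCompletion L)]), a ≠ 0 ∧ z ⬝ᵥ ((redMat (placeForm H' w.1) * redMat (ϖ⁻¹ • (((((q.out⁻¹ * t * q.out)).val : GL (Fin 3) (UnitaryGroup.LocalRing L v)).val.map (Pi.evalRingHom (fun w' : PlacesOver L v => w'.1.adicCompletion L) w)) - 1))) *ᵥ z) = a ^ 2
              · rw [if_pos h4] at h; exact absurd h (by decide)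
              · rw [if_neg h4] at h; exact absurd h (by decide)
      · -- stratum ⇒ reader = 1
        rintro ⟨h1, h2⟩
        rw [hρ, if_neg (by omega), if_pos h2]
    have hn2 : {q : (((cmDatum L 3 H').Local v) ⧸ cmLocalIntegralLevel L 3 H' v) | q ∈ MulAction.fixedBy (((cmDatum L 3 H').Local v) ⧸ cmLocalIntegralLevel L 3 H' v) t ∧ ρ (q.out⁻¹ * t * q.out) = 2}.ncard =
        {q : (((cmDatum L 3 H').Local v) ⧸ cmLocalIntegralLevel L 3 H' v) | q ∈ MulAction.fixedBy (((cmDatum L 3 H').Local v) ⧸ cmLocalIntegralLevel L 3 H' v) t ∧ ((redMat (((((q.out⁻¹ * t * q.out)).val : GL (Fin 3) (UnitaryGroup.LocalRing L v)).val.map (Pi.evalRingHom (fun w' : PlacesOver L v => w'.1.adicCompletion L) w))) - 1).rank = 0 ∧ (redMat (ϖ⁻¹ • (((((q.out⁻¹ * t * q.out)).val : GL (Fin 3) (UnitaryGroup.LocalRing L v)).val.map (Pi.evalRingHom (fun w' : PlacesOver L v => w'.1.adicCompletion L) w)) - 1))).rank = 2)}.ncard := by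
      congr 1
      refine Set.ext fun q => and_congr_right fun hq => ?_
      obtain ⟨hlt, hne, hN⟩ := hfix q hq
      constructor
      · -- reader = 2 ⇒ stratum
        intro h
        rw [hρ] at h
        by_cases hb : (redMat (((((q.out⁻¹ * t * q.out)).val : GL (Fin 3) (UnitaryGroup.LocalRing L v)).val.map (Pi.evalRingHom (fun w' : PlacesOver L v => w'.1.adicCompletion L) w))) - 1).rank = 2
        · rw [if_pos hb] at h; exact absurd h (by decide)
        · have hr0 : (redMat (((((q.out⁻¹ * t * q.out)).val : GL (Fin 3) (UnitaryGroup.LocalRing L v)).val.map (Pi.evalRingHom (fun w' : PlacesOver L v => w'.1.adicCompletion L) w))) - 1).rank = 0 := by omega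
          have hN' := hN hr0
          rw [if_neg hb] at h
          by_cases h0 : (redMat (ϖ⁻¹ • (((((q.out⁻¹ * t * q.out)).val : GL (Fin 3) (UnitaryGroup.LocalRing L v)).val.map (Pi.evalRingHom (fun w' : PlacesOver L v => w'.1.adicCompletion L) w)) - 1))).rank = 0
          · rw [if_pos h0] at h; exact absurd h (by decide)
          · rw [if_neg h0] at h
            by_cases h3 : (redMat (ϖ⁻¹ • (((((q.out⁻¹ * t * q.out)).val : GL (Fin 3) (UnitaryGroup.LocalRing L v)).val.map (Pi.evalRingHom (fun w' : PlacesOver L v => w'.1.adicCompletion L) w)) - 1))).rank = 2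
            · rw [if_pos h3] at h; exact ⟨hr0, h3⟩
            · rw [if_neg h3] at h
              by_cases h4 : ∃ (z : Fin 3 → 𝓀[(w.1.adicCompletion L)]) (a : 𝓀[(w.1.adicCompletion L)]), a ≠ 0 ∧ z ⬝ᵥ ((redMat (placeForm H' w.1) * redMat (ϖ⁻¹ • (((((q.out⁻¹ * t * q.out)).val : GL (Fin 3) (UnitaryGroup.LocalRing L v)).val.map (Pi.evalRingHom (fun w' : PlacesOver L v => w'.1.adicCompletion L) w)) - 1))) *ᵥ z) = a ^ 2
              · rw [if_pos h4] at h; exact absurd h (by decide)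
              · rw [if_neg h4] at h; exact absurd h (by decide)
      · -- stratum ⇒ reader = 2
        rintro ⟨h1, h3⟩
        rw [hρ, if_neg (by omega), if_neg (by omega), if_pos h3]
    have hn3 : {q : (((cmDatum L 3 H').Local v) ⧸ cmLocalIntegralLevel L 3 H' v) | q ∈ MulAction.fixedBy (((cmDatum L 3 H').Local v) ⧸ cmLocalIntegralLevel L 3 H' v) t ∧ ρ (q.out⁻¹ * t * q.out) = 3}.ncard =
        {q : (((cmDatum L 3 H').Local v) ⧸ cmLocalIntegralLevel L 3 H' v) | q ∈ MulAction.fixedBy (((cmDatum L 3 H').Local v) ⧸ cmLocalIntegralLevel L 3 H' v) t ∧ ((redMat (((((q.out⁻¹ * t * q.out)).val : GL (Fin 3) (UnitaryGroup.LocalRing L v)).val.map (Pi.evalRingHom (fun w' : PlacesOver L v => w'.1.adicCompletion L) w))) - 1).rank = 0 ∧ (redMat (ϖ⁻¹ • (((((q.out⁻¹ * t * q.out)).val : GL (Fin 3) (UnitaryGroup.LocalRing L v)).val.map (Pi.evalRingHom (fun w' : PlacesOver L v => w'.1.adicCompletion L) w)) - 1))).rank = 1 ∧ ∃ (z : Fin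 3 → 𝓀[(w.1.adicCompletion L)]) (a : 𝓀[(w.1.adicCompletion L)]), a ≠ 0 ∧ z ⬝ᵥ ((redMat (placeForm H' w.1) * redMat (ϖ⁻¹ • (((((q.out⁻¹ * t * q.out)).val : GL (Fin 3) (UnitaryGroup.LocalRing L v)).val.map (Pi.evalRingHom (fun w' : PlacesOver L v => w'.1.adicCompletion L) w)) - 1))) *ᵥ z) = a ^ 2)}.ncard := by
      congr 1
      refine Set.ext fun q => and_congr_right fun hq => ?_
      obtain ⟨hlt, hne, hN⟩ := hfix q hq
      constructor
      · -- reader = 3 ⇒ stratum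
        intro h
        rw [hρ] at h
        by_cases hb : (redMat (((((q.out⁻¹ * t * q.out)).val : GL (Fin 3) (UnitaryGroup.LocalRing L v)).val.map (Pi.evalRingHom (fun w' : PlacesOver L v => w'.1.adicCompletion L) w))) - 1).rank = 2
        · rw [if_pos hb] at h; exact absurd h (by decide)
        · have hr0 : (redMat (((((q.out⁻¹ * t * q.out)).val : GL (Fin 3) (UnitaryGroup.LocalRing L v)).val.map (Pi.evalRingHom (fun w' : PlacesOver L v => w'.1.adicCompletion L) w))) - 1).rank = 0 := by omega
          have hN' := hN hr0
          rw [if_neg hb] at h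
          by_cases h0 : (redMat (ϖ⁻¹ • (((((q.out⁻¹ * t * q.out)).val : GL (Fin 3) (UnitaryGroup.LocalRing L v)).val.map (Pi.evalRingHom (fun w' : PlacesOver L v => w'.1.adicCompletion L) w)) - 1))).rank = 0
          · rw [if_pos h0] at h; exact absurd h (by decide)
          · rw [if_neg h0] at h
            by_cases h3 : (redMat (ϖ⁻¹ • (((((q.out⁻¹ * t * q.out)).val : GL (Fin 3) (UnitaryGroup.LocalRing L v)).val.map (Pi.evalRingHom (fun w' : PlacesOver L v => w'.1.adicCompletion L) w)) - 1))).rank = 2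
            · rw [if_pos h3] at h; exact absurd h (by decide)
            · rw [if_neg h3] at h
              by_cases h4 : ∃ (z : Fin 3 → 𝓀[(w.1.adicCompletion L)]) (a : 𝓀[(w.1.adicCompletion L)]), a ≠ 0 ∧ z ⬝ᵥ ((redMat (placeForm H' w.1) * redMat (ϖ⁻¹ • (((((q.out⁻¹ * t * q.out)).val : GL (Fin 3) (UnitaryGroup.LocalRing L v)).val.map (Pi.evalRingHom (fun w' : PlacesOver L v => w'.1.adicCompletion L) w)) - 1))) *ᵥ z) = a ^ 2
              · rw [if_pos h4] at h; exact ⟨hr0, by omega, h4⟩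
              · rw [if_neg h4] at h; exact absurd h (by decide)
      · -- stratum ⇒ reader = 3
        rintro ⟨h1, h3, h4⟩
        rw [hρ, if_neg (by omega), if_neg (by omega), if_neg (by omega), if_pos h4]
    have hn4 : {q : (((cmDatum L 3 H').Local v) ⧸ cmLocalIntegralLevel L 3 H' v) | q ∈ MulAction.fixedBy (((cmDatum L 3 H').Local v) ⧸ cmLocalIntegralLevel L 3 H' v) t ∧ ρ (q.out⁻¹ * t * q.out) = 4}.ncard =
        {q : (((cmDatum L 3 H').Local v) ⧸ cmLocalIntegralLevel L 3 H' v) | q ∈ MulAction.fixedBy (((cmDatum L 3 H').Local v) ⧸ cmLocalIntegralLevel L 3 H' v) t ∧ ((redMat (((((q.out⁻¹ * t * q.out)).val : GL (Fin 3) (UnitaryGroup.LocalRing L v)).val.map (Pi.evalRingHom (fun w' : PlacesOver L v => w'.1.adicCompletion L) w))) - 1).rank = 0 ∧ (redMat (ϖ⁻¹ • (((((q.out⁻¹ * t * q.out)).val : GL (Fin 3) (UnitaryGroup.LocalRing L v)).val.map (Pi.evalRingHom (fun w' : PlacesOver L v => w'.1.adicCompletion L) w)) - 1))).rank = 1 ∧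 ¬ ∃ (z : Fin 3 → 𝓀[(w.1.adicCompletion L)]) (a : 𝓀[(w.1.adicCompletion L)]), a ≠ 0 ∧ z ⬝ᵥ ((redMat (placeForm H' w.1) * redMat (ϖ⁻¹ • (((((q.out⁻¹ * t * q.out)).val : GL (Fin 3) (UnitaryGroup.LocalRing L v)).val.map (Pi.evalRingHom (fun w' : PlacesOver L v => w'.1.adicCompletion L) w)) - 1))) *ᵥ z) = a ^ 2)}.ncard := by
      congr 1
      refine Set.ext fun q => and_congr_right fun hq => ?_
      obtain ⟨hlt, hne, hN⟩ := hfix q hq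
      constructor
      · -- reader = 4 ⇒ stratum
        intro h
        rw [hρ] at h
        by_cases hb : (redMat (((((q.out⁻¹ * t * q.out)).val : GL (Fin 3) (UnitaryGroup.LocalRing L v)).val.map (Pi.evalRingHom (fun w' : PlacesOver L v => w'.1.adicCompletion L) w))) - 1).rank = 2
        · rw [if_pos hb] at h; exact absurd h (by decide)
        · have hr0 : (redMat (((((q.out⁻¹ * t * q.out)).val : GL (Fin 3) (UnitaryGroup.LocalRing L v)).val.map (Pi.evalRingHom (fun w' : PlacesOver L v => w'.1.adicCompletion L) w))) - 1).rank = 0 := by omega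
          have hN' := hN hr0
          rw [if_neg hb] at h
          by_cases h0 : (redMat (ϖ⁻¹ • (((((q.out⁻¹ * t * q.out)).val : GL (Fin 3) (UnitaryGroup.LocalRing L v)).val.map (Pi.evalRingHom (fun w' : PlacesOver L v => w'.1.adicCompletion L) w)) - 1))).rank = 0
          · rw [if_pos h0] at h; exact absurd h (by decide)
          · rw [if_neg h0] at h
            by_cases h3 : (redMat (ϖ⁻¹ • (((((q.out⁻¹ * t * q.out)).val : GL (Fin 3) (UnitaryGroup.LocalRing L v)).val.map (Pi.evalRingHom (fun w' : PlacesOver L v => w'.1.adicCompletion L) w)) - 1))).rank = 2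
            · rw [if_pos h3] at h; exact absurd h (by decide)
            · rw [if_neg h3] at h
              by_cases h4 : ∃ (z : Fin 3 → 𝓀[(w.1.adicCompletion L)]) (a : 𝓀[(w.1.adicCompletion L)]), a ≠ 0 ∧ z ⬝ᵥ ((redMat (placeForm H' w.1) * redMat (ϖ⁻¹ • (((((q.out⁻¹ * t * q.out)).val : GL (Fin 3) (UnitaryGroup.LocalRing L v)).val.map (Pi.evalRingHom (fun w' : PlacesOver L v => w'.1.adicCompletion L) w)) - 1))) *ᵥ z) = a ^ 2
              · rw [if_pos h4] at h; exact absurd h (by decide)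
              · rw [if_neg h4] at h; exact ⟨hr0, by omega, h4⟩
      · -- stratum ⇒ reader = 4
        rintro ⟨h1, h3, h4⟩
        rw [hρ, if_neg (by omega), if_neg (by omega), if_neg (by omega), if_neg h4]
    refine (real_smul_sum_range_five_nsmul _ (fun r => {q : (((cmDatum L 3 H').Local v) ⧸ cmLocalIntegralLevel L 3 H' v) | q ∈ MulAction.fixedBy (((cmDatum L 3 H').Local v) ⧸ cmLocalIntegralLevel L 3 H' v) t ∧ ρ (q.out⁻¹ * t * q.out) = r}.ncard) cv).trans ?_
    simp only [hcv0, hcv1, hcv2, hcv3, hcv4, hn0, hn1, hn2, hn3, hn4]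

end Head

end Literature.NumberTheory.Automorphic.UnitaryGroup

end
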